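import Literature.NumberTheory.LFunctions.ConreyIwaniec2002MeanValueDefs
import Mathlib.NumberTheory.Harmonic.Bounds
import Mathlib.Data.Nat.Squarefree
import HarnessLib

/-!
# Conrey–Iwaniec (2002), §4 (4.34): size of the genus factor `F_{v,w}(s)` on vertical lines

B. Conrey, H. Iwaniec, Acta Arith. 103 (2002), §4 (4.34) and §6 (6.23)–(6.26) [held text
`paper:arxiv-math_0111012`, p0012:L125–p0013:L15, p0015:L20–L60]. For the Eisenstein series of the
cusp `1/v` of level `q = vw` (squarefree) the generating series (4.34) of the off-diagonal
coefficients `σ(h)` carries the factor `F_{v,w}(s) = ∏_{p∣v}(p^{-1} − p^{-s})∏_{p∣w}(1 − p^{-s-1})`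
(the tree's `ConreyIwaniec2002.genusZFactor`). The source bounds it through the constant `C` of
(6.23), "`C ≪ (ν(q)/q)L²(1,χ_q) log q`" (6.26), `ν(q)/q = ∏_{p∣q}(1+1/p)` (2.1).

PROVED HERE (inputs of the registered stub S5 `stub_offdiagonal` of SKELETON P64, cell
landau-siegel/ls-inputs, line `thm61-cm-convolution`):
* `norm_genusZFactor_le`: `‖F_{v,w}(s)‖ ≤ ∏_{p∣q}(1+1/p) ≤ Σ_{d∣q} 1/d ≤ 1 + log q` for `Re s ≥ 0`,
  `vw = q` squarefree — the printed size `ν(q)/q` up to the divisor sum;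
* `norm_sq_genusZFactor_le_near_zero`: for `0 ≤ Re s ≤ 1` and SMALL height
  `|Im s| ≤ (log q)^{-1/3}`, `‖F_{v,w}(s)‖² ≤ 30` ABSOLUTELY: only primes `p ∣ q` with
  `|Im s| log p > π/2` (so `p > P = e^{π/(2|Im s|)}`, at most `log q/log P` of them, each
  contributing `≤ (1+1/p)² ≤ exp(2/P)`) can exceed `1 + p^{-2}`. This is the input behind the
  absolute constant of the integrated form of (6.34)–(6.35) (line card R-c).

## References
* [ConreyIwaniec2002] B. Conrey, H. Iwaniec, Acta Arith. 103 (2002) 259–312: §2 (2.1); §4 (4.34); §6 (6.23)–(6.26).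
-/

noncomputable section

open Complex Finset Real

namespace Literature.NumberTheory.LFunctions

namespace ConreyIwaniec2002

namespace GenusZFactorBounds

/-! ### `∏_{p ∣ q} (1 + 1/p) ≤ Σ_{d ∣ q} 1/d ≤ 1 + log q` -/

/-- `∏_{p∣q}(1 + f(p)) ≤ Σ_{d∣q} f(d)` for a multiplicative-on-coprimes weight realised here for
`f(d) = d^{-1}` and `f(d) = d^{-2}`: expansion of the product over subsets of the prime factors,
each subset giving a distinct squarefree divisor. [cite: ConreyIwaniec2002, §2 (2.1)] -/
theorem prod_primeFactors_one_add_inv_pow_le {q : ℕ} (hq : q ≠ 0) (k : ℕ) :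
    ∏ p ∈ q.primeFactors, (1 + ((p : ℝ) ^ k)⁻¹) ≤ ∑ d ∈ q.divisors, ((d : ℝ) ^ k)⁻¹ := by
  classical
  rw [Finset.prod_one_add]
  -- the map `t ↦ ∏_{p ∈ t} p` from subsets of the prime factors to divisors is injective
  set g : Finset ℕ → ℕ := fun t => ∏ p ∈ t, p with hg
  have hg_dvd : ∀ t ∈ q.primeFactors.powerset, g t ∈ q.divisors := by
    intro t ht
    rw [Finset.mem_powerset] at ht
    rw [Nat.mem_divisors]
    refine ⟨?_, hq⟩
    exact (Finset.prod_dvd_prod_of_subset _ _ _ ht).trans (Nat.prod_primeFactors_dvd q)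
  have hg_inj : Set.InjOn g (q.primeFactors.powerset : Set (Finset ℕ)) := by
    intro t₁ ht₁ t₂ ht₂ h
    rw [Finset.coe_powerset, Set.mem_preimage, Set.mem_powerset_iff, Finset.coe_subset] at ht₁ ht₂
    have hp₁ : ∀ p ∈ t₁, p.Prime := fun p hp => Nat.prime_of_mem_primeFactors (ht₁ hp)
    have hp₂ : ∀ p ∈ t₂, p.Prime := fun p hp => Nat.prime_of_mem_primeFactors (ht₂ hp)
    have h1 : (g t₁).primeFactors = t₁ := Nat.primeFactors_prod hp₁
    have h2 : (g t₂).primeFactors = t₂ := Nat.primeFactors_prod hp₂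
    rw [← h1, ← h2, h]
  have hterm : ∀ t ∈ q.primeFactors.powerset,
      ∏ p ∈ t, ((p : ℝ) ^ k)⁻¹ = (((g t : ℕ) : ℝ) ^ k)⁻¹ := by
    intro t _
    rw [hg]
    push_cast
    rw [← Finset.prod_pow (s := t) (n := k) (f := fun i : ℕ => (i : ℝ)),
      ← Finset.prod_inv_distrib]
  rw [Finset.sum_congr rfl hterm]
  calc ∑ t ∈ q.primeFactors.powerset, (((g t : ℕ) : ℝ) ^ k)⁻¹
      = ∑ d ∈ (q.primeFactors.powerset).image g, ((d : ℝ) ^ k)⁻¹ :=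
        (Finset.sum_image (f := fun d : ℕ => ((d : ℝ) ^ k)⁻¹) hg_inj).symm
    _ ≤ ∑ d ∈ q.divisors, ((d : ℝ) ^ k)⁻¹ :=
        Finset.sum_le_sum_of_subset_of_nonneg (Finset.image_subset_iff.mpr hg_dvd)
          fun d _ _ => by positivity

/-- `Σ_{d∣q} 1/d ≤ 1 + log q`. [cite: ConreyIwaniec2002, §2 (2.1)] -/
theorem sum_divisors_inv_le {q : ℕ} (hq : q ≠ 0) :
    ∑ d ∈ q.divisors, ((d : ℝ))⁻¹ ≤ 1 + Real.log q := by
  have h1 : ∑ d ∈ q.divisors, ((d : ℝ))⁻¹ ≤ ∑ d ∈ Finset.Icc 1 q, ((d : ℝ))⁻¹ :=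
    Finset.sum_le_sum_of_subset_of_nonneg (fun d hd => by
      rw [Finset.mem_Icc]; rw [Nat.mem_divisors] at hd
      exact ⟨Nat.pos_of_dvd_of_pos hd.1 (Nat.pos_of_ne_zero hq), Nat.le_of_dvd (Nat.pos_of_ne_zero hq) hd.1⟩)
      fun d _ _ => by positivity
  have h2 : ∀ n : ℕ, ∑ d ∈ Finset.Icc 1 n, ((d : ℝ))⁻¹ = (harmonic n : ℝ) := by
    intro n
    induction n with
    | zero => simp
    | succ n ih =>
      rw [Finset.sum_Icc_succ_top (by omega), ih, harmonic_succ]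
      push_cast
      ring
  rw [h2] at h1
  exact h1.trans (harmonic_le_one_add_log q)

/-- **`‖F_{v,w}(s)‖ ≤ 1 + log q`** for `Re s ≥ 0` and `vw = q` squarefree: each factor has modulus
`≤ 1 + 1/p`, and `∏_{p∣q}(1+1/p) ≤ Σ_{d∣q}1/d`. [cite: ConreyIwaniec2002, §4 (4.34); §6 (6.26)] -/
theorem norm_genusZFactor_le {q v w : ℕ} (hq : Squarefree q) (hvw : v * w = q) {s : ℂ}
    (hs : 0 ≤ s.re) : ‖genusZFactor v w s‖ ≤ 1 + Real.log q := by
  have hq0 : q ≠ 0 := hq.ne_zero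
  have hv0 : v ≠ 0 := by rintro rfl; simp at hvw; exact hq0 hvw.symm
  have hw0 : w ≠ 0 := by rintro rfl; simp at hvw; exact hq0 hvw.symm
  have hcop : Nat.Coprime v w := by
    rw [← hvw] at hq; exact (Nat.squarefree_mul_iff.mp hq).1
  -- factor bounds
  have hp1 : ∀ p ∈ v.primeFactors, ‖((p : ℂ)⁻¹ - (p : ℂ) ^ (-s))‖ ≤ 1 + ((p : ℝ) ^ 1)⁻¹ := by
    intro p hp
    have hpp : p.Prime := Nat.prime_of_mem_primeFactors hp
    have hp0 : (0 : ℝ) < p := by exact_mod_cast hpp.pos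
    have hp1 : (1 : ℝ) ≤ p := by exact_mod_cast hpp.one_lt.le
    calc ‖((p : ℂ)⁻¹ - (p : ℂ) ^ (-s))‖ ≤ ‖(p : ℂ)⁻¹‖ + ‖(p : ℂ) ^ (-s)‖ := norm_sub_le _ _
      _ ≤ ((p : ℝ) ^ 1)⁻¹ + 1 := by
          gcongr
          · rw [norm_inv, Complex.norm_natCast, pow_one]
          · rw [Complex.norm_natCast_cpow_of_pos hpp.pos, Complex.neg_re]
            exact Real.rpow_le_one_of_one_le_of_nonpos hp1 (by linarith)
      _ = 1 + ((p : ℝ) ^ 1)⁻¹ := add_comm _ _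
  have hp2 : ∀ p ∈ w.primeFactors, ‖(1 - (p : ℂ) ^ (-s - 1))‖ ≤ 1 + ((p : ℝ) ^ 1)⁻¹ := by
    intro p hp
    have hpp : p.Prime := Nat.prime_of_mem_primeFactors hp
    have hp1 : (1 : ℝ) ≤ p := by exact_mod_cast hpp.one_lt.le
    calc ‖(1 - (p : ℂ) ^ (-s - 1))‖ ≤ ‖(1 : ℂ)‖ + ‖(p : ℂ) ^ (-s - 1)‖ := norm_sub_le _ _
      _ ≤ 1 + ((p : ℝ) ^ 1)⁻¹ := by
          rw [norm_one]
          gcongr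
          rw [Complex.norm_natCast_cpow_of_pos hpp.pos, pow_one, ← Real.rpow_neg_one]
          refine Real.rpow_le_rpow_of_exponent_le hp1 ?_
          simp; linarith
  have hn1 : ‖∏ p ∈ v.primeFactors, ((p : ℂ)⁻¹ - (p : ℂ) ^ (-s))‖ ≤
      ∏ p ∈ v.primeFactors, (1 + ((p : ℝ) ^ 1)⁻¹) := by
    rw [Complex.norm_prod]
    exact Finset.prod_le_prod (fun p _ => norm_nonneg _) hp1
  have hn2 : ‖∏ p ∈ w.primeFactors, (1 - (p : ℂ) ^ (-s - 1))‖ ≤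
      ∏ p ∈ w.primeFactors, (1 + ((p : ℝ) ^ 1)⁻¹) := by
    rw [Complex.norm_prod]
    exact Finset.prod_le_prod (fun p _ => norm_nonneg _) hp2
  unfold genusZFactor
  rw [norm_mul]
  calc ‖∏ p ∈ v.primeFactors, ((p : ℂ)⁻¹ - (p : ℂ) ^ (-s))‖ *
        ‖∏ p ∈ w.primeFactors, (1 - (p : ℂ) ^ (-s - 1))‖
      ≤ (∏ p ∈ v.primeFactors, (1 + ((p : ℝ) ^ 1)⁻¹)) *
          ∏ p ∈ w.primeFactors, (1 + ((p : ℝ) ^ 1)⁻¹) :=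
        mul_le_mul hn1 hn2 (norm_nonneg _) (Finset.prod_nonneg fun p _ => by positivity)
    _ = ∏ p ∈ q.primeFactors, (1 + ((p : ℝ) ^ 1)⁻¹) := by
        rw [← hvw, hcop.primeFactors_mul, Finset.prod_union hcop.disjoint_primeFactors]
    _ ≤ ∑ d ∈ q.divisors, ((d : ℝ) ^ 1)⁻¹ := prod_primeFactors_one_add_inv_pow_le hq0 1
    _ = ∑ d ∈ q.divisors, ((d : ℝ))⁻¹ := by simp
    _ ≤ 1 + Real.log q := sum_divisors_inv_le hq0

/-! ### The per-prime factors -/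

/-- For a prime `p` and `s = σ + it`: `(p^{-s}).re = p^{-σ} cos(t log p)` and `‖p^{-s}‖ = p^{-σ}`.
[cite: ConreyIwaniec2002, §4 (4.34)] -/
theorem natCast_cpow_neg_re {p : ℕ} (hp : 0 < p) (s : ℂ) :
    (((p : ℂ) ^ (-s)).re) = (p : ℝ) ^ (-s.re) * Real.cos (s.im * Real.log p) := by
  have hp0 : (p : ℂ) ≠ 0 := by exact_mod_cast hp.ne'
  rw [Complex.cpow_def_of_ne_zero hp0, Complex.exp_re]
  have hlog : Complex.log (p : ℂ) = (Real.log p : ℂ) := (Complex.natCast_log).symm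
  rw [hlog]
  simp only [Complex.mul_re, Complex.mul_im, Complex.ofReal_re, Complex.ofReal_im,
    Complex.neg_re, Complex.neg_im, sub_zero, zero_mul, add_zero]
  rw [Real.rpow_def_of_pos (by exact_mod_cast hp)]
  rw [show Real.log (p : ℝ) * -s.im = -(s.im * Real.log p) by ring, Real.cos_neg]

/-- The squared factor of `p ∣ v`: `|p^{-1} − p^{-s}|² = p^{-2} + p^{-2σ} − 2p^{-1-σ}cos(t log p)`,
hence `≤ 1 + p^{-2}` when `cos(t log p) ≥ 0` and `≤ (1 + 1/p)²` always (here in the combined form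
`≤ (1 + p^{-2})·B` with `B = 1` or `exp(2/p)`). [cite: ConreyIwaniec2002, §4 (4.34)] -/
theorem normSq_factor_v_le {p : ℕ} (hp : p.Prime) {s : ℂ} (hs : 0 ≤ s.re) :
    ‖((p : ℂ)⁻¹ - (p : ℂ) ^ (-s))‖ ^ 2 ≤
      (1 + ((p : ℝ) ^ 2)⁻¹) *
        (if Real.pi / 2 < |s.im| * Real.log p then Real.exp (2 / p) else 1) := by
  have hp0 : (0 : ℝ) < p := by exact_mod_cast hp.pos
  have hp1 : (1 : ℝ) ≤ p := by exact_mod_cast hp.one_lt.le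
  have hpσ : (p : ℝ) ^ (-s.re) ≤ 1 := Real.rpow_le_one_of_one_le_of_nonpos hp1 (by linarith)
  have hpσ0 : 0 ≤ (p : ℝ) ^ (-s.re) := Real.rpow_nonneg hp0.le _
  have hnorm : ‖(p : ℂ) ^ (-s)‖ = (p : ℝ) ^ (-s.re) := by
    rw [Complex.norm_natCast_cpow_of_pos hp.pos]; simp
  have hre := natCast_cpow_neg_re hp.pos s
  -- the exact formula
  have hform : ‖((p : ℂ)⁻¹ - (p : ℂ) ^ (-s))‖ ^ 2 =
      ((p : ℝ)⁻¹) ^ 2 + ((p : ℝ) ^ (-s.re)) ^ 2 -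
        2 * ((p : ℝ)⁻¹ * ((p : ℝ) ^ (-s.re) * Real.cos (s.im * Real.log p))) := by
    rw [Complex.sq_norm, Complex.normSq_sub, Complex.normSq_eq_norm_sq, Complex.normSq_eq_norm_sq,
      hnorm, norm_inv, Complex.norm_natCast]
    congr 1
    have : ((p : ℂ)⁻¹ * (starRingEnd ℂ) ((p : ℂ) ^ (-s))).re = (p : ℝ)⁻¹ * ((p : ℂ) ^ (-s)).re := by
      rw [Complex.mul_re, Complex.conj_re, Complex.conj_im]
      simp [Complex.inv_re, Complex.inv_im, Complex.normSq_natCast]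
    rw [this, hre]
  by_cases hbad : Real.pi / 2 < |s.im| * Real.log p
  · rw [if_pos hbad]
    -- crude: ‖·‖ ≤ 1/p + 1, squared ≤ (1+1/p)² ≤ exp(2/p) ≤ (1+p⁻²) exp(2/p)
    have h1 : ‖((p : ℂ)⁻¹ - (p : ℂ) ^ (-s))‖ ≤ 1 + (p : ℝ)⁻¹ := by
      calc ‖((p : ℂ)⁻¹ - (p : ℂ) ^ (-s))‖ ≤ ‖(p : ℂ)⁻¹‖ + ‖(p : ℂ) ^ (-s)‖ := norm_sub_le _ _
        _ ≤ (p : ℝ)⁻¹ + 1 := by rw [norm_inv, Complex.norm_natCast, hnorm]; gcongr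
        _ = 1 + (p : ℝ)⁻¹ := add_comm _ _
    have h2 : (1 + (p : ℝ)⁻¹) ^ 2 ≤ Real.exp (2 / p) := by
      have := Real.add_one_le_exp ((p : ℝ)⁻¹)
      calc (1 + (p : ℝ)⁻¹) ^ 2 = ((p : ℝ)⁻¹ + 1) ^ 2 := by ring
        _ ≤ (Real.exp ((p : ℝ)⁻¹)) ^ 2 := pow_le_pow_left₀ (by positivity) this 2
        _ = Real.exp (2 / p) := by rw [← Real.exp_nat_mul]; ring_nf
    calc ‖((p : ℂ)⁻¹ - (p : ℂ) ^ (-s))‖ ^ 2 ≤ (1 + (p : ℝ)⁻¹) ^ 2 :=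
          pow_le_pow_left₀ (norm_nonneg _) h1 2
      _ ≤ Real.exp (2 / p) := h2
      _ ≤ (1 + ((p : ℝ) ^ 2)⁻¹) * Real.exp (2 / p) :=
          le_mul_of_one_le_left (Real.exp_nonneg _) (le_add_of_nonneg_right (by positivity))
  · rw [if_neg hbad, mul_one]
    have hcos : 0 ≤ Real.cos (s.im * Real.log p) := by
      have habs : |s.im * Real.log p| ≤ Real.pi / 2 := by
        rw [abs_mul, abs_of_nonneg (Real.log_nonneg hp1)]; exact not_lt.mp hbad
      exact Real.cos_nonneg_of_neg_pi_div_two_le_of_le (abs_le.mp habs).1 (abs_le.mp habs).2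
    rw [hform]
    have h3 : 0 ≤ 2 * ((p : ℝ)⁻¹ * ((p : ℝ) ^ (-s.re) * Real.cos (s.im * Real.log p))) := by
      positivity
    have h4 : ((p : ℝ) ^ (-s.re)) ^ 2 ≤ 1 := pow_le_one₀ hpσ0 hpσ
    have h5 : ((p : ℝ)⁻¹) ^ 2 = ((p : ℝ) ^ 2)⁻¹ := by rw [inv_pow]
    linarith

/-- The squared factor of `p ∣ w`: `|1 − p^{-1-s}|² ≤ (1 + p^{-2})·B`, `B` as above.
[cite: ConreyIwaniec2002, §4 (4.34)] -/
theorem normSq_factor_w_le {p : ℕ} (hp : p.Prime) {s : ℂ} (hs : 0 ≤ s.re) :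
    ‖(1 - (p : ℂ) ^ (-s - 1))‖ ^ 2 ≤
      (1 + ((p : ℝ) ^ 2)⁻¹) *
        (if Real.pi / 2 < |s.im| * Real.log p then Real.exp (2 / p) else 1) := by
  have hp0 : (0 : ℝ) < p := by exact_mod_cast hp.pos
  have hp1 : (1 : ℝ) ≤ p := by exact_mod_cast hp.one_lt.le
  -- `-s-1 = -(s+1)`
  have hs1 : -s - 1 = -(s + 1) := by ring
  have hnorm : ‖(p : ℂ) ^ (-s - 1)‖ = (p : ℝ) ^ (-(s.re + 1)) := by
    rw [hs1, Complex.norm_natCast_cpow_of_pos hp.pos]; simp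
  have hpσ : (p : ℝ) ^ (-(s.re + 1)) ≤ (p : ℝ)⁻¹ := by
    rw [← Real.rpow_neg_one]
    exact Real.rpow_le_rpow_of_exponent_le hp1 (by linarith)
  have hpσ0 : 0 ≤ (p : ℝ) ^ (-(s.re + 1)) := Real.rpow_nonneg hp0.le _
  have hpinv1 : (p : ℝ)⁻¹ ≤ 1 := inv_le_one_of_one_le₀ hp1
  have hre : ((p : ℂ) ^ (-s - 1)).re = (p : ℝ) ^ (-(s.re + 1)) * Real.cos (s.im * Real.log p) := by
    rw [hs1, natCast_cpow_neg_re hp.pos (s + 1)]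
    simp
  have hform : ‖(1 - (p : ℂ) ^ (-s - 1))‖ ^ 2 =
      1 + ((p : ℝ) ^ (-(s.re + 1))) ^ 2 - 2 * ((p : ℝ) ^ (-(s.re + 1)) * Real.cos (s.im * Real.log p)) := by
    rw [Complex.sq_norm, Complex.normSq_sub, Complex.normSq_eq_norm_sq, Complex.normSq_eq_norm_sq,
      hnorm, norm_one, one_pow, one_mul, Complex.conj_re, hre]
  by_cases hbad : Real.pi / 2 < |s.im| * Real.log p
  · rw [if_pos hbad]
    have h1 : ‖(1 - (p : ℂ) ^ (-s - 1))‖ ≤ 1 + (p : ℝ)⁻¹ := by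
      calc ‖(1 - (p : ℂ) ^ (-s - 1))‖ ≤ ‖(1 : ℂ)‖ + ‖(p : ℂ) ^ (-s - 1)‖ := norm_sub_le _ _
        _ ≤ 1 + (p : ℝ)⁻¹ := by rw [norm_one, hnorm]; gcongr
    have h2 : (1 + (p : ℝ)⁻¹) ^ 2 ≤ Real.exp (2 / p) := by
      have := Real.add_one_le_exp ((p : ℝ)⁻¹)
      calc (1 + (p : ℝ)⁻¹) ^ 2 = ((p : ℝ)⁻¹ + 1) ^ 2 := by ring
        _ ≤ (Real.exp ((p : ℝ)⁻¹)) ^ 2 := pow_le_pow_left₀ (by positivity) this 2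
        _ = Real.exp (2 / p) := by rw [← Real.exp_nat_mul]; ring_nf
    calc ‖(1 - (p : ℂ) ^ (-s - 1))‖ ^ 2 ≤ (1 + (p : ℝ)⁻¹) ^ 2 :=
          pow_le_pow_left₀ (norm_nonneg _) h1 2
      _ ≤ Real.exp (2 / p) := h2
      _ ≤ (1 + ((p : ℝ) ^ 2)⁻¹) * Real.exp (2 / p) :=
          le_mul_of_one_le_left (Real.exp_nonneg _) (le_add_of_nonneg_right (by positivity))
  · rw [if_neg hbad, mul_one]
    have hcos : 0 ≤ Real.cos (s.im * Real.log p) := by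
      have habs : |s.im * Real.log p| ≤ Real.pi / 2 := by
        rw [abs_mul, abs_of_nonneg (Real.log_nonneg hp1)]; exact not_lt.mp hbad
      exact Real.cos_nonneg_of_neg_pi_div_two_le_of_le (abs_le.mp habs).1 (abs_le.mp habs).2
    rw [hform]
    have h3 : 0 ≤ 2 * ((p : ℝ) ^ (-(s.re + 1)) * Real.cos (s.im * Real.log p)) := by positivity
    have h4 : ((p : ℝ) ^ (-(s.re + 1))) ^ 2 ≤ ((p : ℝ) ^ 2)⁻¹ := by
      rw [← inv_pow]; exact pow_le_pow_left₀ hpσ0 hpσ 2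
    linarith

/-! ### The bound near `t = 0` -/

/-- `Σ_{d∣q} 1/d² ≤ 2` (elementary; used for `∏_{p∣q}(1 + p^{-2}) ≤ 2`).
[cite: ConreyIwaniec2002, §2 (2.1)] -/
theorem sum_divisors_inv_sq_le_two {q : ℕ} (hq : q ≠ 0) :
    ∑ d ∈ q.divisors, (((d : ℝ)) ^ 2)⁻¹ ≤ 2 := by
  have h1 : ∑ d ∈ q.divisors, (((d : ℝ)) ^ 2)⁻¹ ≤ ∑ d ∈ Finset.Icc 1 q, (((d : ℝ)) ^ 2)⁻¹ :=
    Finset.sum_le_sum_of_subset_of_nonneg (fun d hd => by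
      rw [Finset.mem_Icc]; rw [Nat.mem_divisors] at hd
      exact ⟨Nat.pos_of_dvd_of_pos hd.1 (Nat.pos_of_ne_zero hq), Nat.le_of_dvd (Nat.pos_of_ne_zero hq) hd.1⟩)
      fun d _ _ => by positivity
  have hsplit : Finset.Icc 1 q = insert 1 (Finset.Ioo 1 (q + 1)) := by
    ext d; simp [Finset.mem_Icc, Finset.mem_Ioo]; omega
  rw [hsplit, Finset.sum_insert (by simp)] at h1
  have h2 := sum_Ioo_inv_sq_le (α := ℝ) 1 (q + 1)
  norm_num at h1 h2 ⊢
  linarith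

/-- The counting step: if every prime in `B ⊆ primeFactors q` exceeds `P > 1`, then
`#B · log P ≤ log q` (because `P^{#B} ≤ ∏_{p ∈ B} p ≤ q`). [cite: ConreyIwaniec2002, §2 (2.1)] -/
theorem card_mul_log_le_log {q : ℕ} (hq : q ≠ 0) {B : Finset ℕ} (hB : B ⊆ q.primeFactors)
    {P : ℝ} (hP : 1 < P) (hBP : ∀ p ∈ B, P ≤ (p : ℝ)) :
    (B.card : ℝ) * Real.log P ≤ Real.log q := by
  have hP0 : 0 < P := by linarith
  have hprod_le : (∏ p ∈ B, (p : ℝ)) ≤ q := by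
    have h1 : (∏ p ∈ B, p) ∣ q :=
      (Finset.prod_dvd_prod_of_subset _ _ _ hB).trans (Nat.prod_primeFactors_dvd q)
    have h2 : (∏ p ∈ B, p) ≤ q := Nat.le_of_dvd (Nat.pos_of_ne_zero hq) h1
    have h3 : ((∏ p ∈ B, p : ℕ) : ℝ) ≤ (q : ℝ) := by exact_mod_cast h2
    simpa [Nat.cast_prod] using h3
  have hpow : P ^ B.card ≤ ∏ p ∈ B, (p : ℝ) := by
    rw [← Finset.prod_const]
    exact Finset.prod_le_prod (fun p _ => hP0.le) hBP
  have h := Real.log_le_log (pow_pos hP0 _) (hpow.trans hprod_le)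
  rwa [Real.log_pow] at h

/-- **`‖F_{v,w}(s)‖² ≤ 30` for `Re s ≥ 0`, `|Im s| ≤ (log q)^{-1/3}`, `vw = q` squarefree,
`q ≥ 5`**: the primes `p ∣ q` with `|Im s| log p > π/2` are `> P = e^{π/(2|Im s|)}`, number at most
`log q/log P`, and contribute `exp(2 Σ 1/p) ≤ exp(2 (2|t| log q/π) e^{-π/(2|t|)}) ≤ exp(32/π³)`; the
others contribute `≤ ∏(1+p^{-2}) ≤ 2`. (The ABSOLUTE constant behind the integrated form of
(6.34)–(6.35); contrast the sup over all `t`, which is `≍ ∏_{p∣q}(1+1/p)`.)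
[cite: ConreyIwaniec2002, §4 (4.34); §6 (6.26)] -/
theorem norm_sq_genusZFactor_le_near_zero {q v w : ℕ} (hq : Squarefree q) (hq5 : 5 ≤ q)
    (hvw : v * w = q) {s : ℂ} (hs : 0 ≤ s.re)
    (ht : |s.im| ≤ (Real.log q) ^ (-(1 / 3 : ℝ))) :
    ‖genusZFactor v w s‖ ^ 2 ≤ 30 := by
  classical
  have hq0 : q ≠ 0 := hq.ne_zero
  have hcop : Nat.Coprime v w := by
    rw [← hvw] at hq; exact (Nat.squarefree_mul_iff.mp hq).1
  have hq5' : (5 : ℝ) ≤ q := by exact_mod_cast hq5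
  -- `L = log q ≥ 1`
  set L : ℝ := Real.log q with hL
  have hL1 : 1 ≤ L := by
    rw [hL, ← Real.log_exp 1]
    exact Real.log_le_log (Real.exp_pos 1) (by linarith [Real.exp_one_lt_three])
  have hL0 : 0 < L := by linarith
  -- the per-prime weights
  set Bw : ℕ → ℝ := fun p : ℕ =>
    if Real.pi / 2 < |s.im| * Real.log (p : ℝ) then Real.exp (2 / (p : ℝ)) else 1 with hBw
  -- Step 1: `‖F‖² ≤ ∏_{p ∣ q} (1 + p⁻²) Bw(p)`
  have hstep1 : ‖genusZFactor v w s‖ ^ 2 ≤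
      ∏ p ∈ q.primeFactors, ((1 + ((p : ℝ) ^ 2)⁻¹) * Bw p) := by
    unfold genusZFactor
    rw [norm_mul, mul_pow, Complex.norm_prod, Complex.norm_prod, ← Finset.prod_pow,
      ← Finset.prod_pow, ← hvw, hcop.primeFactors_mul, Finset.prod_union hcop.disjoint_primeFactors]
    refine mul_le_mul ?_ ?_ (Finset.prod_nonneg fun p _ => by positivity)
      (Finset.prod_nonneg fun p _ => by positivity)
    · exact Finset.prod_le_prod (fun p _ => by positivity)
        fun p hp => normSq_factor_v_le (Nat.prime_of_mem_primeFactors hp) hs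
    · exact Finset.prod_le_prod (fun p _ => by positivity)
        fun p hp => normSq_factor_w_le (Nat.prime_of_mem_primeFactors hp) hs
  -- Step 2: split the product
  rw [Finset.prod_mul_distrib] at hstep1
  have hA : ∏ p ∈ q.primeFactors, (1 + ((p : ℝ) ^ 2)⁻¹) ≤ 2 :=
    (prod_primeFactors_one_add_inv_pow_le hq0 2).trans (sum_divisors_inv_sq_le_two hq0)
  -- Step 3: `∏ Bw = exp(2 Σ_{bad} 1/p)`
  set bad : Finset ℕ := q.primeFactors.filter (fun p : ℕ => Real.pi / 2 < |s.im| * Real.log (p : ℝ))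
    with hbad
  have hB : ∏ p ∈ q.primeFactors, Bw p = Real.exp (∑ p ∈ bad, 2 / (p : ℝ)) := by
    rw [Real.exp_sum, hbad, Finset.prod_filter]
  -- Step 4: `Σ_{bad} 2/p ≤ 2 · 16/π³ ≤ 32/27`
  have hsum : ∑ p ∈ bad, 2 / (p : ℝ) ≤ 32 / 27 := by
    by_cases ht0 : s.im = 0
    · have : bad = ∅ := by
        rw [hbad, Finset.filter_eq_empty_iff]
        intro p _
        rw [ht0, abs_zero, zero_mul]; linarith [Real.pi_pos]
      rw [this, Finset.sum_empty]; norm_num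
    have htpos : 0 < |s.im| := abs_pos.mpr ht0
    set P : ℝ := Real.exp (Real.pi / (2 * |s.im|)) with hP
    have hP1 : 1 < P := by
      rw [hP]; exact Real.one_lt_exp_iff.mpr (by positivity)
    have hP0 : 0 < P := by linarith
    -- bad primes exceed `P`
    have hbadP : ∀ p ∈ bad, P ≤ (p : ℝ) := by
      intro p hp
      rw [hbad, Finset.mem_filter] at hp
      have hpp : p.Prime := Nat.prime_of_mem_primeFactors hp.1
      have hp0 : (0:ℝ) < p := by exact_mod_cast hpp.pos
      have h1 : Real.pi / (2 * |s.im|) < Real.log p := by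
        rw [div_lt_iff₀ (by positivity)]; linarith [hp.2]
      rw [hP, ← Real.exp_log hp0]
      exact Real.exp_le_exp.mpr h1.le
    have hcard : (bad.card : ℝ) * (Real.pi / (2 * |s.im|)) ≤ L := by
      have := card_mul_log_le_log hq0 (Finset.filter_subset _ _) hP1 hbadP
      rwa [hP, Real.log_exp] at this
    -- `Σ_{bad} 2/p ≤ 2 #bad / P`
    have hs1 : ∑ p ∈ bad, 2 / (p : ℝ) ≤ 2 * (bad.card : ℝ) * P⁻¹ := by
      calc ∑ p ∈ bad, 2 / (p : ℝ) ≤ ∑ p ∈ bad, 2 * P⁻¹ :=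
            Finset.sum_le_sum fun p hp => by
              rw [div_eq_mul_inv]
              gcongr
              exact hbadP p hp
        _ = 2 * (bad.card : ℝ) * P⁻¹ := by rw [Finset.sum_const, nsmul_eq_mul]; ring
    -- `#bad ≤ 2|t|L/π` and `P⁻¹ = exp(-π/(2|t|))`
    have hcard' : (bad.card : ℝ) ≤ 2 * |s.im| * L / Real.pi := by
      rw [le_div_iff₀ Real.pi_pos]
      have := hcard
      rw [mul_div_assoc'] at this
      rw [div_le_iff₀ (by positivity)] at this
      linarith
    -- with `|t| ≤ τ = L^{-1/3}`: `|t| L ≤ L^{2/3}` and `exp(-π/(2|t|)) ≤ exp(-(π/2) L^{1/3})`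
    set y : ℝ := L ^ ((1 : ℝ) / 3) with hy
    have hy0 : 0 < y := Real.rpow_pos_of_pos hL0 _
    have hτ : (Real.log q) ^ (-(1 / 3 : ℝ)) = y⁻¹ := by
      rw [hy, hL, Real.rpow_neg (Real.log_nonneg (by linarith))]
    have hty : |s.im| ≤ y⁻¹ := hτ ▸ ht
    have hy3 : y ^ (3 : ℕ) = L := by
      rw [hy, ← Real.rpow_natCast, ← Real.rpow_mul hL0.le]; norm_num
    have htL : |s.im| * L ≤ y ^ 2 := by
      calc |s.im| * L ≤ y⁻¹ * L := mul_le_mul_of_nonneg_right hty hL0.le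
        _ = y ^ 2 := by rw [← hy3]; field_simp
    have hPinv : P⁻¹ ≤ Real.exp (-(Real.pi / 2 * y)) := by
      rw [hP, ← Real.exp_neg, Real.exp_le_exp]
      have h1 : Real.pi / 2 * y ≤ Real.pi / (2 * |s.im|) := by
        rw [le_div_iff₀ (by positivity)]
        have : y * |s.im| ≤ 1 := by
          calc y * |s.im| ≤ y * y⁻¹ := mul_le_mul_of_nonneg_left hty hy0.le
            _ = 1 := mul_inv_cancel₀ hy0.ne'
        nlinarith [Real.pi_pos]
      linarith
    -- `exp(-(π/2) y) ≤ 8/(π² y²)`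
    have hexp : Real.exp (-(Real.pi / 2 * y)) ≤ 8 / (Real.pi ^ 2 * y ^ 2) := by
      have h1 := Real.pow_div_factorial_le_exp (x := Real.pi / 2 * y) (by positivity) 2
      simp only [Nat.factorial_two, Nat.cast_ofNat] at h1
      rw [Real.exp_neg, inv_le_comm₀ (Real.exp_pos _) (by positivity)]
      calc (8 / (Real.pi ^ 2 * y ^ 2))⁻¹ = (Real.pi / 2 * y) ^ 2 / 2 := by field_simp; ring
        _ ≤ Real.exp (Real.pi / 2 * y) := h1
    have hpi3 : (3 : ℝ) < Real.pi := Real.pi_gt_three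
    calc ∑ p ∈ bad, 2 / (p : ℝ) ≤ 2 * (bad.card : ℝ) * P⁻¹ := hs1
      _ ≤ 2 * (2 * |s.im| * L / Real.pi) * Real.exp (-(Real.pi / 2 * y)) := by
          gcongr
      _ ≤ 2 * (2 * y ^ 2 / Real.pi) * (8 / (Real.pi ^ 2 * y ^ 2)) := by
          have h2L : 2 * |s.im| * L / Real.pi ≤ 2 * y ^ 2 / Real.pi := by
            apply div_le_div_of_nonneg_right _ Real.pi_pos.le
            nlinarith
          gcongr
      _ = 32 / Real.pi ^ 3 := by field_simp; ring
      _ ≤ 32 / 27 := by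
          rw [div_le_div_iff_of_pos_left (by norm_num) (by positivity) (by norm_num)]
          nlinarith
  -- Step 5: assemble
  have hexp2 : Real.exp (∑ p ∈ bad, 2 / (p : ℝ)) ≤ 15 := by
    calc Real.exp (∑ p ∈ bad, 2 / (p : ℝ)) ≤ Real.exp (32 / 27) := Real.exp_le_exp.mpr hsum
      _ ≤ Real.exp 1 * Real.exp 1 := by
          rw [← Real.exp_add]; exact Real.exp_le_exp.mpr (by norm_num)
      _ ≤ 15 := by nlinarith [Real.exp_one_lt_three, Real.exp_pos 1]
  calc ‖genusZFactor v w s‖ ^ 2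
      ≤ (∏ p ∈ q.primeFactors, (1 + ((p : ℝ) ^ 2)⁻¹)) * ∏ p ∈ q.primeFactors, Bw p := hstep1
    _ ≤ 2 * 15 := by
        rw [hB]
        exact mul_le_mul hA hexp2 (Real.exp_nonneg _) (by norm_num)
    _ = 30 := by norm_num

end GenusZFactorBounds

end ConreyIwaniec2002

end Literature.NumberTheory.LFunctions

end
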